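import Literature.NumberTheory.Automorphic.IdeleClassCharacterAutConjCMType
import HarnessLib

/-!
# The `Gal(ℂ/ℚ)`-action on conjugate symplectic automorphic characters and its orbits
# ([Liu21] Cor. 4.20: "representatives of `Gal(ℂ/ℚ)`-orbits of all conjugate symplectic automorphic
# characters of `𝔸_E^×` of weight one")

Topic `NumberTheory/Automorphic`; namespace `Literature.NumberTheory.Automorphic` (grouping sub-namespace
`IdeleClassGroup`, as in the companion files).  Two index sets with bodies, two `MulAction` instances, theorems;
**no named fact, no `sorry`** (D-0026).  Sequel of `IdeleClassCharacterAutConj` (`IsConjugateSymplectic.autConj hψ σ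
= σμ`, `autConj_eq_self_iff`, `natCard_range_autConj`), `IdeleClassCharacterAutConjSelfDual`
(`isConjugateSymplectic_autConj`, `hasWeight_autConj`: the index set is `Aut(ℂ)`-stable) and
`IdeleClassCharacterAutConjCMType` (`IsConjugateSymplectic.autConj_autConj`: the group law `σ(τμ) = (στ)μ`,
`IsConjugateSymplectic.autConj_one`).

SOURCE.  Y. Liu, *Fourier–Jacobi cycles and arithmetic relative trace formula*, Camb. J. Math. **9** (2021)
= arXiv:2102.11518 [Liu2021], TeX source `FJcycle.tex` (md5 6db49a74122d).

AS PRINTED (Cor. 4.20, TeX l. 2307; = Thm. 1.1 (1), l. 664): "there is an isogeny decomposition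
`A_K ∼ ∏_μ A_μ^{d(μ,K)}` … of abelian varieties over `E` when `n ≥ 3` …, where the product is taken over
representatives of `Gal(ℂ/ℚ)`-orbits of all conjugate symplectic automorphic characters of `𝔸_E^×` of weight one."
And (l. 2316): "It is clear that the integer `d(μ,K)` depends only on the `Gal(ℂ/ℚ)`-orbit of `μ`."  The proof of
Thm. 4.18 (3) (l. 2272) uses "`Gal(ℂ/M_μ)` stabilizes `μ`".  Liu does not spell out the action; the reading forced
by l. 1924–1928 ("`μ^{alg} ≔ μ·|·|_E^{-1/2}` … `M_μ ⊆ ℂ` the subfield generated by values `μ^{alg}(x)` for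
`x ∈ (𝔸_E^∞)^×`") and l. 2272 is Weil's (1956): `σ` sends `μ` to the unitary character `σμ` with
`(σμ)^{alg} = ^σ(μ^{alg})` — the tree's `IdeleClassGroup.autConj` / `IsConjugateSymplectic.autConj`.

WHAT IS HERE (`L` a CM field; `Aut(ℂ) = (ℂ ≃ₐ[ℚ] ℂ)`, every ring automorphism of `ℂ` being `ℚ`-linear).
* `conjSymplecticChars L`, `conjSymplecticWeightOneChars L` — the sets of conjugate symplectic unitary characters
  `ψ : C_L →ₜ* S¹` (resp. those of weight one): the printed index set of Cor. 4.20 BEFORE passing to orbits.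
* `MulAction (ℂ ≃ₐ[ℚ] ℂ)` instances on both, `σ • μ ≔ σμ` (`coe_smul`; axioms = `autConj_one`, `autConj_autConj`
  of the companion files; closure = `isConjugateSymplectic_autConj`, `hasWeight_autConj`) — so that
  "`Gal(ℂ/ℚ)`-orbit of `μ`" is literally `MulAction.orbit (ℂ ≃ₐ[ℚ] ℂ) μ` and "representatives of the orbits" is
  `MulAction.orbitRel.Quotient`.
* `mem_orbit_iff` (`ν ∈ Aut(ℂ)·μ ↔ ∃ σ, σμ = ν`), **`natCard_orbit_eq_finrank`** (`|Aut(ℂ)·μ| = [M_μ:ℚ]`, from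
  `natCard_range_autConj`), **`mem_stabilizer_iff`** ("`Gal(ℂ/M_μ)` stabilizes `μ`" and conversely: the stabiliser
  is `Aut(ℂ/M_μ)`, from `autConj_eq_self_iff`), `muAlgValueField_smul` (`M_{σμ} = σ(M_μ)`).
* **`exists_orbitReps`** (both index sets) — a choice of orbit representatives `rep` with `rep μ ∈ Aut(ℂ)·μ`,
  `rep` constant on orbits (so `rep ∘ rep = rep`), and for every representative `ν` the fibre `{μ | rep μ = ν}`
  — the orbit of `ν` — has `[M_ν:ℚ]` elements: EXACTLY the shape of the displayed inputs `rep`/`hrep`/`hcard`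
  (with `isRep ν :↔ rep ν = ν`, `degM ν := [M_ν:ℚ]`) of the tree's orbit count
  `Liu2021.LiuAlbaneseDatum.finsum_d_eq_finsum_reps` / `LiuAlbaneseCMDatum.cor420_of_thm418_of_orbits`
  (`AlgebraicGeometry/Liu2021/AlbaneseIsogenyDecomposition.lean`), now available over the real characters.

NOT HERE.  (i) "`d(μ,K)` depends only on the orbit" (l. 2316) — a statement about the oscillator representations
`ω(μ,ε,χ)` (CITE; input `hdrep` of `finsum_d_eq_finsum_reps`).  (ii) The instantiation of a whole
`LiuAlbaneseDatum` with `Char :=` one of the index sets below (its other carriers — `A_μ`, levels, `ω` — are the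
stage-1 package's; consumer-gated).

## References

* [Liu2021] Y. Liu, *Fourier–Jacobi cycles and arithmetic relative trace formula*, Camb. J. Math. 9 (2021),
  no. 1, 1–147, arXiv:2102.11518 — Cor. 4.20 (TeX ll. 2301–2316), Thm. 1.1 (l. 664), proof of Thm. 4.18 (3)
  (l. 2272), Def. 4.1 / Def. 4.3 (ll. 1900–1921).
* [Weil1956] A. Weil, *On a certain type of characters of the idèle-class group of an algebraic number-field*,
  Proc. Int. Symp. Tokyo–Nikko 1955 (1956), 1–7 — §1 (`^σχ`).
-/

set_option autoImplicit false

noncomputable section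

open NumberField

namespace Literature.NumberTheory.Automorphic

namespace IdeleClassGroup

/-! ## § 0. Orbit representatives for a group action (bookkeeping) -/

section Reps

variable {G X : Type*} [Group G] [MulAction G X]

/-- A choice of orbit representatives: `rep x ∈ G·x`, and `rep` is constant on orbits (`Quotient.out` of the
orbit relation). [folklore] -/
private theorem exists_rep_mem_orbit :
    ∃ rep : X → X, (∀ x, rep x ∈ MulAction.orbit G x) ∧
      ∀ x y, y ∈ MulAction.orbit G x → rep y = rep x := by
  classical
  refine ⟨fun x => (Quotient.mk (MulAction.orbitRel G X) x).out, fun x => ?_, fun x y h => ?_⟩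
  · exact MulAction.orbitRel_apply.1 (Quotient.mk_out (s := MulAction.orbitRel G X) x)
  · dsimp only
    rw [Quotient.sound (MulAction.orbitRel_apply.2 h : MulAction.orbitRel G X y x)]

/-- For such a choice, the fibre of `rep` over a representative `ν` (`rep ν = ν`) is the orbit of `ν`.
[folklore] -/
private theorem setOf_rep_eq_eq_orbit {rep : X → X} (h1 : ∀ x, rep x ∈ MulAction.orbit G x)
    (h2 : ∀ x y, y ∈ MulAction.orbit G x → rep y = rep x) {ν : X} (hν : rep ν = ν) :
    {μ | rep μ = ν} = MulAction.orbit G ν := by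
  ext μ
  simp only [Set.mem_setOf_eq]
  constructor
  · intro hμ
    rw [MulAction.mem_orbit_symm, ← hμ]
    exact h1 μ
  · intro hμ
    rw [h2 ν μ hμ, hν]

/-- Packaging: representatives with `rep ∘ rep = rep` and fibres over representatives = orbits, counted by
`Nat.card`. [folklore] -/
private theorem exists_rep (card : X → ℕ) (hcard : ∀ x, Nat.card (MulAction.orbit G x) = card x) :
    ∃ rep : X → X, (∀ x, rep x ∈ MulAction.orbit G x) ∧
      (∀ x y, y ∈ MulAction.orbit G x → rep y = rep x) ∧ (∀ x, rep (rep x) = rep x) ∧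
      ∀ ν, rep ν = ν → Nat.card {μ // rep μ = ν} = card ν := by
  obtain ⟨rep, h1, h2⟩ := exists_rep_mem_orbit (G := G) (X := X)
  refine ⟨rep, h1, h2, fun x => h2 x (rep x) (h1 x), fun ν hν => ?_⟩
  rw [← hcard ν, ← setOf_rep_eq_eq_orbit h1 h2 hν]
  rfl

end Reps

/-! ## § 1. The index sets of [Liu21] Cor. 4.20 and the `Gal(ℂ/ℚ)`-action `σ • μ = σμ` -/

section IndexSets

variable (L : Type) [Field L] [NumberField L] [IsCMField L]

/-- **The conjugate symplectic automorphic characters of `𝔸_L^×`** ([Liu21] Def. 4.1), as a set of unitary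
idele class characters `ψ : C_L →ₜ* S¹` (`IsConjugateSymplectic`: trivial on the norms `N_{L/L⁺} 𝔸_L^×` and equal
to `μ_{L/L⁺}` on `𝔸_{L⁺}^×`). [cite: Liu2021, Def. 4.1 (TeX l. 1901)] -/
def conjSymplecticChars : Set (IdeleClassGroup L →ₜ* Circle) := {ψ | IsConjugateSymplectic L ψ}

/-- **The index set of [Liu21] Cor. 4.20 before passing to orbits: "all conjugate symplectic automorphic
characters of `𝔸_E^×` of weight one"** (`HasWeight L ψ 1`, Def. 4.3 (1): `𝔴_μ` constant `= 1`).
[cite: Liu2021, Cor. 4.20 and Def. 4.3 (1) (TeX ll. 2307, 1917)] -/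
def conjSymplecticWeightOneChars : Set (IdeleClassGroup L →ₜ* Circle) :=
  {ψ | IsConjugateSymplectic L ψ ∧ HasWeight L ψ 1}

variable {L}

/-- Membership in `conjSymplecticChars`. [cite: Liu2021, Def. 4.1 (TeX l. 1901)] -/
@[simp] theorem mem_conjSymplecticChars_iff {ψ : IdeleClassGroup L →ₜ* Circle} :
    ψ ∈ conjSymplecticChars L ↔ IsConjugateSymplectic L ψ := Iff.rfl

/-- Membership in `conjSymplecticWeightOneChars`. [cite: Liu2021, Cor. 4.20 (TeX l. 2307)] -/
@[simp] theorem mem_conjSymplecticWeightOneChars_iff {ψ : IdeleClassGroup L →ₜ* Circle} :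
    ψ ∈ conjSymplecticWeightOneChars L ↔ IsConjugateSymplectic L ψ ∧ HasWeight L ψ 1 := Iff.rfl

/-- The weight-one characters are among the conjugate symplectic ones. [cite: Liu2021, Cor. 4.20 (TeX l. 2307)] -/
theorem conjSymplecticWeightOneChars_subset : conjSymplecticWeightOneChars L ⊆ conjSymplecticChars L :=
  fun _ h => h.1

/-- **The `Gal(ℂ/ℚ)`-action on conjugate symplectic automorphic characters**: `σ • μ ≔ σμ`
(`IsConjugateSymplectic.autConj`, the unitary character with `(σμ)^{alg} = ^σ(μ^{alg})`; it is again conjugate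
symplectic, `isConjugateSymplectic_autConj`); `1μ = μ` (`IsConjugateSymplectic.autConj_one`) and
`σ(τμ) = (στ)μ` (`IsConjugateSymplectic.autConj_autConj`). [cite: Liu2021, Cor. 4.20 (TeX ll. 2307–2316)] [cite: Weil1956, §1] -/
instance : MulAction (ℂ ≃ₐ[ℚ] ℂ) (conjSymplecticChars L) where
  smul σ μ := ⟨IsConjugateSymplectic.autConj μ.2 σ, IsConjugateSymplectic.isConjugateSymplectic_autConj μ.2 σ⟩
  one_smul μ := Subtype.ext (IsConjugateSymplectic.autConj_one μ.2)
  mul_smul σ τ μ := Subtype.ext (IsConjugateSymplectic.autConj_autConj μ.2 σ τ).symm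

/-- **The `Gal(ℂ/ℚ)`-action on Cor. 4.20's index set** (conjugate symplectic of weight one; weight one is
preserved, `IsConjugateSymplectic.hasWeight_autConj`). [cite: Liu2021, Cor. 4.20 (TeX ll. 2307–2316)] [cite: Weil1956, §1] -/
instance : MulAction (ℂ ≃ₐ[ℚ] ℂ) (conjSymplecticWeightOneChars L) where
  smul σ μ := ⟨IsConjugateSymplectic.autConj μ.2.1 σ, IsConjugateSymplectic.isConjugateSymplectic_autConj μ.2.1 σ, IsConjugateSymplectic.hasWeight_autConj μ.2.1 μ.2.2 σ⟩
  one_smul μ := Subtype.ext (IsConjugateSymplectic.autConj_one μ.2.1)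
  mul_smul σ τ μ := Subtype.ext (IsConjugateSymplectic.autConj_autConj μ.2.1 σ τ).symm

/-- `σ • μ` is `σμ`. [cite: Liu2021, Cor. 4.20 (TeX l. 2307)] -/
@[simp] theorem coe_smul (σ : ℂ ≃ₐ[ℚ] ℂ) (μ : conjSymplecticChars L) :
    ((σ • μ : conjSymplecticChars L) : IdeleClassGroup L →ₜ* Circle) = IsConjugateSymplectic.autConj μ.2 σ := rfl

/-- `σ • μ` is `σμ` (weight-one index set). [cite: Liu2021, Cor. 4.20 (TeX l. 2307)] -/
@[simp] theorem coe_smul_weightOne (σ : ℂ ≃ₐ[ℚ] ℂ) (μ : conjSymplecticWeightOneChars L) :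
    ((σ • μ : conjSymplecticWeightOneChars L) : IdeleClassGroup L →ₜ* Circle) = IsConjugateSymplectic.autConj μ.2.1 σ := rfl

/-- The inclusion of index sets is `Aut(ℂ)`-equivariant. [cite: Liu2021, Cor. 4.20 (TeX l. 2307)] -/
theorem coe_inclusion_smul (σ : ℂ ≃ₐ[ℚ] ℂ) (μ : conjSymplecticWeightOneChars L) :
    Set.inclusion conjSymplecticWeightOneChars_subset (σ • μ) =
      σ • Set.inclusion conjSymplecticWeightOneChars_subset μ := rfl

end IndexSets

/-! ## § 2. Orbits: membership, size `[M_μ:ℚ]`, stabiliser `Aut(ℂ/M_μ)` -/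

section Orbits

variable {L : Type} [Field L] [NumberField L] [IsCMField L]

/-- `ν ∈ Aut(ℂ)·μ ↔ ν = σμ` for some `σ`. [cite: Liu2021, Cor. 4.20 (TeX l. 2307)] -/
theorem mem_orbit_iff {μ ν : conjSymplecticChars L} :
    ν ∈ MulAction.orbit (ℂ ≃ₐ[ℚ] ℂ) μ ↔ ∃ σ : ℂ ≃ₐ[ℚ] ℂ, IsConjugateSymplectic.autConj μ.2 σ = ν.1 := by
  rw [MulAction.mem_orbit_iff]
  exact exists_congr fun σ => Subtype.ext_iff

/-- `ν ∈ Aut(ℂ)·μ ↔ ν = σμ` for some `σ` (weight-one index set). [cite: Liu2021, Cor. 4.20 (TeX l. 2307)] -/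
theorem mem_orbit_iff_weightOne {μ ν : conjSymplecticWeightOneChars L} :
    ν ∈ MulAction.orbit (ℂ ≃ₐ[ℚ] ℂ) μ ↔ ∃ σ : ℂ ≃ₐ[ℚ] ℂ, IsConjugateSymplectic.autConj μ.2.1 σ = ν.1 := by
  rw [MulAction.mem_orbit_iff]
  exact exists_congr fun σ => Subtype.ext_iff

/-- `M_{σμ} = σ(M_μ)` along the action (`IsConjugateSymplectic.muAlgValueField_autConj`).
[cite: Liu2021, §4.1 and Remark 4.4 (TeX ll. 1926–1933)] -/
theorem muAlgValueField_smul (σ : ℂ ≃ₐ[ℚ] ℂ) (μ : conjSymplecticChars L) :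
    muAlgValueField L (σ • μ).1 = (muAlgValueField L μ.1).map (σ : ℂ ≃ₐ[ℚ] ℂ).toRingEquiv.toRingHom :=
  IsConjugateSymplectic.muAlgValueField_autConj μ.2 σ

/-- The underlying characters of an orbit are the conjugates `σμ`. [folklore] -/
private theorem image_val_orbit (μ : conjSymplecticChars L) :
    Subtype.val '' MulAction.orbit (ℂ ≃ₐ[ℚ] ℂ) μ = Set.range fun σ : ℂ ≃ₐ[ℚ] ℂ => IsConjugateSymplectic.autConj μ.2 σ := by
  ext ψ
  simp only [Set.mem_image, Set.mem_range]
  constructor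
  · rintro ⟨ν, hν, rfl⟩
    exact mem_orbit_iff.1 hν
  · rintro ⟨σ, rfl⟩
    exact ⟨σ • μ, MulAction.mem_orbit _ σ, rfl⟩

/-- The same for the weight-one index set. [folklore] -/
private theorem image_val_orbit_weightOne (μ : conjSymplecticWeightOneChars L) :
    Subtype.val '' MulAction.orbit (ℂ ≃ₐ[ℚ] ℂ) μ = Set.range fun σ : ℂ ≃ₐ[ℚ] ℂ => IsConjugateSymplectic.autConj μ.2.1 σ := by
  ext ψ
  simp only [Set.mem_image, Set.mem_range]
  constructor
  · rintro ⟨ν, hν, rfl⟩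
    exact mem_orbit_iff_weightOne.1 hν
  · rintro ⟨σ, rfl⟩
    exact ⟨σ • μ, MulAction.mem_orbit _ σ, rfl⟩

/-- **The `Gal(ℂ/ℚ)`-orbit of a conjugate symplectic `μ` has `[M_μ : ℚ]` elements**, now for the literal orbit
of the action (`natCard_range_autConj` of the companion file counts `{σμ : σ ∈ Aut(ℂ)}`).
[cite: Liu2021, Cor. 4.20 (TeX ll. 2307–2316)] -/
theorem natCard_orbit_eq_finrank (μ : conjSymplecticChars L) :
    Nat.card (MulAction.orbit (ℂ ≃ₐ[ℚ] ℂ) μ) = Module.finrank ℚ (muAlgValueField L μ.1) := by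
  rw [← IsConjugateSymplectic.natCard_range_autConj μ.2, ← image_val_orbit μ]
  exact Nat.card_congr (Equiv.Set.image _ _ Subtype.val_injective)

/-- **The `Gal(ℂ/ℚ)`-orbit of a conjugate symplectic `μ` of weight one has `[M_μ : ℚ]` elements** (Cor. 4.20's
index set). [cite: Liu2021, Cor. 4.20 (TeX ll. 2307–2316)] -/
theorem natCard_orbit_eq_finrank_weightOne (μ : conjSymplecticWeightOneChars L) :
    Nat.card (MulAction.orbit (ℂ ≃ₐ[ℚ] ℂ) μ) = Module.finrank ℚ (muAlgValueField L μ.1) := by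
  rw [← IsConjugateSymplectic.natCard_range_autConj μ.2.1, ← image_val_orbit_weightOne μ]
  exact Nat.card_congr (Equiv.Set.image _ _ Subtype.val_injective)

/-- The orbits are finite. [cite: Liu2021, Cor. 4.20 (TeX ll. 2307–2316)] -/
theorem finite_orbit (μ : conjSymplecticChars L) : (MulAction.orbit (ℂ ≃ₐ[ℚ] ℂ) μ).Finite := by
  have h := natCard_orbit_eq_finrank μ
  have hpos : 0 < Module.finrank ℚ (muAlgValueField L μ.1) := by
    haveI := IsConjugateSymplectic.finiteDimensional_muAlgValueField μ.2
    exact Module.finrank_pos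
  rw [← h] at hpos
  exact Nat.finite_of_card_ne_zero hpos.ne'

/-- **"`Gal(ℂ/M_μ)` stabilizes `μ`", and conversely** ([Liu21], proof of Thm. 4.18 (3)): the stabiliser of `μ`
for the action is `Aut(ℂ/M_μ)` — `σ • μ = μ ↔ σ` fixes `M_μ` pointwise (`autConj_eq_self_iff`).
[cite: Liu2021, proof of Thm. 4.18 (3) (TeX l. 2272)] -/
theorem mem_stabilizer_iff (σ : ℂ ≃ₐ[ℚ] ℂ) (μ : conjSymplecticChars L) :
    σ ∈ MulAction.stabilizer (ℂ ≃ₐ[ℚ] ℂ) μ ↔ ∀ z ∈ muAlgValueField L μ.1, σ z = z := by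
  rw [MulAction.mem_stabilizer_iff, Subtype.ext_iff]
  exact IsConjugateSymplectic.autConj_eq_self_iff μ.2 σ

/-- The stabiliser statement for the weight-one index set. [cite: Liu2021, proof of Thm. 4.18 (3) (TeX l. 2272)] -/
theorem mem_stabilizer_iff_weightOne (σ : ℂ ≃ₐ[ℚ] ℂ) (μ : conjSymplecticWeightOneChars L) :
    σ ∈ MulAction.stabilizer (ℂ ≃ₐ[ℚ] ℂ) μ ↔ ∀ z ∈ muAlgValueField L μ.1, σ z = z := by
  rw [MulAction.mem_stabilizer_iff, Subtype.ext_iff]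
  exact IsConjugateSymplectic.autConj_eq_self_iff μ.2.1 σ

end Orbits

/-! ## § 3. Orbit representatives: the displayed inputs `rep` / `hrep` / `hcard` of the tree's Cor. 4.20 count -/

section Representatives

variable (L : Type) [Field L] [NumberField L] [IsCMField L]

/-- **Representatives of the `Gal(ℂ/ℚ)`-orbits of conjugate symplectic automorphic characters.**  There is a
choice `rep` of orbit representatives (`rep μ ∈ Aut(ℂ)·μ`, constant on orbits, hence `rep (rep μ) = rep μ`) such
that for every representative `ν` the fibre `{μ | rep μ = ν}` — the orbit of `ν` — has `[M_ν : ℚ]` elements: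
the inputs `rep`, `hrep` (with `isRep ν :↔ rep ν = ν`) and `hcard` (with `degM ν := [M_ν:ℚ]`) of
`Liu2021.LiuAlbaneseDatum.finsum_d_eq_finsum_reps`, over the real characters.
[cite: Liu2021, Cor. 4.20 (TeX ll. 2307–2316)] -/
theorem exists_orbitReps :
    ∃ rep : conjSymplecticChars L → conjSymplecticChars L,
      (∀ μ, rep μ ∈ MulAction.orbit (ℂ ≃ₐ[ℚ] ℂ) μ) ∧
      (∀ μ ν, ν ∈ MulAction.orbit (ℂ ≃ₐ[ℚ] ℂ) μ → rep ν = rep μ) ∧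
      (∀ μ, rep (rep μ) = rep μ) ∧
      ∀ ν, rep ν = ν → Nat.card {μ // rep μ = ν} = Module.finrank ℚ (muAlgValueField L ν.1) :=
  exists_rep (G := ℂ ≃ₐ[ℚ] ℂ) (fun ν : conjSymplecticChars L => Module.finrank ℚ (muAlgValueField L ν.1))
    natCard_orbit_eq_finrank

/-- **Representatives of the `Gal(ℂ/ℚ)`-orbits of Cor. 4.20's index set** (conjugate symplectic of weight one):
`rep μ ∈ Aut(ℂ)·μ`, `rep` constant on orbits, `rep ∘ rep = rep`, and the fibre over a representative `ν` has
`[M_ν : ℚ]` elements — "the product is taken over representatives of `Gal(ℂ/ℚ)`-orbits …; summing over all `μ`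
instead counts each `A_ν` with multiplicity `[M_ν:ℚ]`" (`finsum_d_eq_finsum_reps`).
[cite: Liu2021, Cor. 4.20 (TeX ll. 2307–2316)] -/
theorem exists_orbitReps_weightOne :
    ∃ rep : conjSymplecticWeightOneChars L → conjSymplecticWeightOneChars L,
      (∀ μ, rep μ ∈ MulAction.orbit (ℂ ≃ₐ[ℚ] ℂ) μ) ∧
      (∀ μ ν, ν ∈ MulAction.orbit (ℂ ≃ₐ[ℚ] ℂ) μ → rep ν = rep μ) ∧
      (∀ μ, rep (rep μ) = rep μ) ∧
      ∀ ν, rep ν = ν → Nat.card {μ // rep μ = ν} = Module.finrank ℚ (muAlgValueField L ν.1) :=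
  exists_rep (G := ℂ ≃ₐ[ℚ] ℂ)
    (fun ν : conjSymplecticWeightOneChars L => Module.finrank ℚ (muAlgValueField L ν.1))
    natCard_orbit_eq_finrank_weightOne

end Representatives

end IdeleClassGroup

end Literature.NumberTheory.Automorphic

end
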